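import Literature.MathematicalPhysics.QuantumFieldTheory.Balaban1983to89.B8Eq1117KLevel
import Literature.MathematicalPhysics.QuantumFieldTheory.Balaban1983to89.B7GaugeFixingAtBackground

/-!
# `Balaban1983to89.B8Eq1117KLevelWitness` — NON-VACUITY WITNESS for the hypothesis set of this seat's k-level Sect. E theorems
# (`B8Eq1117KLevel.eq1117_existsUnique_kLevel`, [Balaban1985RegularSpaces] (1.117) «exactly one solution» at `k` levels): the
# twenty-odd structural and smallness hypotheses are JOINTLY SATISFIABLE — at the trivial background `U₀ = 1`, `B = 0` (so `U₁ = 1`),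
# `λ = 0`, `H′ = 0`, `B′₀ = 1`, `c = 0`, explicit `α₀(d, L)`, `α₄(d, L)`, an ARBITRARY constraint set `S` at the top level `k`, and
# `u₁` = [3]'s gauge fixing of the trivial data — the theorem APPLIES and yields its `∃!` conclusion (bookkeeping hygiene A1–A6:
# «inhabited hypotheses, no ex falso»)

statement-level skeleton of published theorems with citation tags; proofs where landed; nothing here is a claim about the Yang–Mills mass gap

T. Bałaban, *Spaces of regular gauge field configurations on a lattice and gauge fixing conditions*, Commun.
Math. Phys. **99** (1985) 75–102 `[Balaban1985RegularSpaces]` ("B8"), (1.117)–(1.121) pp. 96–97; [3] = [Balaban1985Averaging].  STATUS: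
published, refereed.

CITATION HEADER (lean-in-tree rule).  Cell `pub-ymgap` (YM Track A, DAG node N05 = [B8]), seat `pub-ymgap-dag-n05-b`, gen 0; dag-lead
[REBALANCE-26] closer (b) («the A1–A6 / INHABITED-AT-k hygiene required at booking time»).  WHAT IS CERTIFIED = a WITNESS, not a sentence of
print: the hypothesis list of `B8Eq1117KLevel.eq1117_existsUnique_kLevel` (tower-local (1.33)/(1.69)/`u₁ = glev_j`/(1.119)/H′-modulus and
the `j`-free smallness inherited from `B8Eq1115Concrete.eq214_local_B8` / `B8Eq1122Local.lipschitz1122_local` / p05's `B8Eq1117Concrete`) is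
consistent.  Kind «kernel-checked proof», theorems only: no `def`, no `… : Prop` fact, no existing module modified.  REUSED BY NAME:
`B8Eq1117KLevel.eq1117_existsUnique_kLevel`, `B8Ineq132.pdevOn_lt_of_forall`, `B8Ineq130.hol_one`, the lineage's constants `B7Prop2Explicit.{C0,
c2'}`, `B7Prop3Flat.c3`, `B7Prop10General.{C6, C7, C4G}`, `B7Prop10Flat.{C5, C4'}`, `B7Prop9Flat.C5'`, `B7Eq214General.Cgen`,
`B8Ineq125Concrete.C2p`, Mathlib's `Real.log_two_gt_d9`.

## WHAT IS CERTIFIED HERE (kernel; axioms `propext` / `Classical.choice` / `Quot.sound`)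

* §1 explicit small parameters: `K0 d L := C0 d + 3200(d+1)²(d+4) + C4G d L + 1024(d+1)(d+4)L² + 32(d+1)²C6 L² + 16d·C5′·C6·L² + 8d·C6·L + 1`
  and `K4 d L := 400 C6 + 24000(d+1)L + 16 C4G + 8 C2p + 1` (written out inline; no `def`), `α₀ := c2′(d,L)/(4·K0)`, `α₄ := 1/K4`;
  the (private) arithmetic lemmas `smallness_alpha0`, `smallness_alpha4` collecting every numeric hypothesis of `eq1117_existsUnique_kLevel` at
  `c = 0`, `B′₀ = 1`.
* §2 **`eq1117_kLevel_witness`** — for every `d`, `L ≥ 2`, `k`, averaging-closed `G`, and every set `S` of top-level constraint sites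
  (`Λ_k = S`, `Λ_j = ∅` for `j ≠ k`), the hypotheses of `eq1117_existsUnique_kLevel` hold at `U₀ = 1`, `B = 0`, `λ = 0`, `H′ = 0`,
  `u₁ = glev L _ 1 e^{0} k 0`, with the parameters of §1 — certified by APPLYING the theorem (conclusion: the `∃!` of (1.117) for this data).

## HONEST SCOPE

A consistency witness only (the trivial configuration); it says nothing about Bałaban's objects beyond «the hypothesis class is
inhabited with a non-empty constraint set».  The constraint set is placed at ONE level (the top one, arbitrary `S`); inhabiting all levels
simultaneously with `u₁ = 1` needs `glev(1, 1) = 1`, a bookkeeping identity of [3]'s (104)–(106) not in the tree as a lemma (not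
attempted here).  Nothing here is progress on the summit.

## v1.1 (APPEND-ONLY, seat `pub-ymgap-dag-n04-b` gen 2): §3 the witness at ALL levels simultaneously

The bookkeeping identity named above is now the tree theorem `B7GaugeFixingAtBackground.glev_one_right`
(`glev L hL U₀ 1 k j = 1` for every background `U₀` and every level `j`; [Balaban1985Averaging] (76)–(77)/(87)).  §3
**`eq1117_kLevel_witness_allLevels`**: the SAME data as §2 except `u₁ := 1` and an ARBITRARY family of constraint sets
`Λ : ℕ → Set (Site d)` (every level inhabited at once) satisfy every hypothesis of `eq1117_existsUnique_kLevel` — the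
hypothesis `u₁ = glev L _ 1 e^{0} j 0` on the level-`j` towers now holds at all `j` by `glev_one_right` and
`B7Prop3GeneralRotated.expCfg_zero`.  §§1–2 are byte-identical to v1 (p414159); one `import` line is added.
-/

noncomputable section

open NormedSpace Finset

namespace Literature.MathematicalPhysics.QuantumFieldTheory.Balaban1983to89.B8Eq1117KLevelWitness

open B7Prop1Explicit B7Prop2Explicit B7Prop3Flat B7Prop1Local B7Eq167Flat B7Eq167General
open B7Eq170Flat (cj cj_apply)
open B7Prop10General (C6 C7 C4G)
open B7Prop10Flat (C5 one_le_C5 C4'_nonneg C5'_nonneg)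
open B7Prop9Flat (C5' C4')
open B7Eq214General (Cgen)
open B8Ineq130 (tlo thi hol_one)
open B7Eq84Concrete (glev)
open B8Eq1123Concrete (Cnl)
open B8Ineq125Concrete (C2p C2p_nonneg)
open B8Eq1117Concrete (XSpace)
open B8Ineq132 (pdevOn_lt_of_forall)
open B8Eq1117KLevel (eq1117_existsUnique_kLevel)

-- `Site` alone could resolve to the torus sites of `Setup.lean`; re-export the `ℤ^d` sites of `B7Prop1Explicit`.
export B7Prop1Explicit (Site)

variable {d : ℕ}

/-! ## §1 Explicit small parameters and the numeric hypotheses -/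

section Arithmetic

/-- Nonnegativity of the lineage's constants entering the smallness conditions. [folklore] -/
private theorem consts_nonneg (d L : ℕ) :
    0 ≤ C0 d ∧ 0 ≤ C6 d ∧ 0 ≤ C7 d ∧ 0 ≤ C4G d L ∧ 0 ≤ C5' d ∧ 0 < C2p d ∧ 0 ≤ c3 d L := by
  have h5 := one_le_C5 (d := d)
  have h6 : (2 : ℝ) ≤ C6 d := by unfold C6; linarith
  have h5' := C5'_nonneg (d := d)
  have h7 : (0 : ℝ) ≤ C7 d := by unfold C7; linarith
  have h4' := C4'_nonneg (d := d)
  refine ⟨by unfold C0; positivity, by linarith, h7, by unfold C4G; positivity, h5', by unfold C2p Cgen; positivity,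
    by unfold c3; positivity⟩

/-- **The `α₀`-smallness of `eq1117_existsUnique_kLevel` at `c = 0`**, for `α₀ := c2′/(4K0)` with
`K0 = C0 + 3200(d+1)²(d+4) + C4G + 1024(d+1)(d+4)L² + 32(d+1)²C6L² + 16dC5′C6L² + 8dC6L + 1`. [folklore] -/
private theorem smallness_alpha0 (d L : ℕ) (hL : 2 ≤ L) :
    let K0 : ℝ := C0 d + 3200 * ((d : ℝ) + 1) ^ 2 * ((d : ℝ) + 4) + C4G d L + 1024 * ((d : ℝ) + 1) * ((d : ℝ) + 4) * L ^ 2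
      + 32 * ((d : ℝ) + 1) ^ 2 * C6 d * L ^ 2 + 16 * d * C5' d * C6 d * (L : ℝ) ^ 2 + 8 * d * C6 d * L + 1
    let α₀ : ℝ := c2' d L / (4 * K0)
    0 < α₀ ∧ C0 d * α₀ ≤ 1 / 3 ∧ 4 * α₀ ≤ c2' d L ∧
      Real.exp (4 * (800 * ((d : ℝ) + 1) ^ 2 * ((d : ℝ) + 4)) * α₀) * (1 + 8 * (131072 * ((d : ℝ) + 1) ^ 2) * (0 : ℝ)) ≤ 2 ∧
      C4G d L * α₀ ≤ 1 / 4 ∧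
      1024 * ((d : ℝ) + 1) * ((d : ℝ) + 4) * L ^ 2 * α₀ ≤ 1 ∧ 32 * ((d : ℝ) + 1) ^ 2 * C6 d * L ^ 2 * α₀ ≤ 1 ∧
      16 * d * C5' d * C6 d * (L : ℝ) ^ 2 * α₀ ≤ 1 ∧ 8 * d * C6 d * L * α₀ ≤ 1 := by
  intro K0 α₀
  obtain ⟨hC0, hC6, -, hC4G, hC5', -, -⟩ := consts_nonneg d L
  have hL1 : (1 : ℝ) ≤ L := by exact_mod_cast le_trans (by norm_num) hL
  have hc2pos : 0 < c2' d L := by unfold c2'; positivity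
  have hc2le : c2' d L ≤ 1 := by
    unfold c2'
    rw [div_le_one (by positivity)]
    have h1 : (1 : ℝ) ≤ (d : ℝ) + 1 := by linarith [(d.cast_nonneg : (0 : ℝ) ≤ d)]
    have h2 : (4 : ℝ) ≤ (d : ℝ) + 4 := by linarith [(d.cast_nonneg : (0 : ℝ) ≤ d)]
    have h3 : (1 : ℝ) ≤ (L : ℝ) ^ 2 := by nlinarith
    calc (1 : ℝ) ≤ 512 * 1 * 4 * 1 := by norm_num
      _ ≤ 512 * ((d : ℝ) + 1) * ((d : ℝ) + 4) * (L : ℝ) ^ 2 := by gcongr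
  have hK0 : 1 ≤ K0 := by
    show (1 : ℝ) ≤ C0 d + _ + _ + _ + _ + _ + _ + 1
    have : (0 : ℝ) ≤ 3200 * ((d : ℝ) + 1) ^ 2 * ((d : ℝ) + 4) := by positivity
    have : (0 : ℝ) ≤ 1024 * ((d : ℝ) + 1) * ((d : ℝ) + 4) * L ^ 2 := by positivity
    have : (0 : ℝ) ≤ 32 * ((d : ℝ) + 1) ^ 2 * C6 d * L ^ 2 := by positivity
    have : (0 : ℝ) ≤ 16 * d * C5' d * C6 d * (L : ℝ) ^ 2 := by positivity
    have : (0 : ℝ) ≤ 8 * d * C6 d * L := by positivity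
    linarith
  have hK0pos : 0 < K0 := by linarith
  have hα₀pos : 0 < α₀ := by positivity
  -- `α₀ ≤ 1/(4K0)` and `F·α₀ ≤ 1/4` for every summand `F` of `K0`
  have hα₀le : α₀ ≤ 1 / (4 * K0) := by
    show c2' d L / (4 * K0) ≤ 1 / (4 * K0)
    exact div_le_div_of_nonneg_right hc2le (by positivity)
  have quarter : ∀ F : ℝ, 0 ≤ F → F ≤ K0 → F * α₀ ≤ 1 / 4 := by
    intro F hF hFK
    calc F * α₀ ≤ K0 * (1 / (4 * K0)) := mul_le_mul hFK hα₀le hα₀pos.le hK0pos.le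
      _ = 1 / 4 := by field_simp
  have s1 : (0 : ℝ) ≤ 3200 * ((d : ℝ) + 1) ^ 2 * ((d : ℝ) + 4) := by positivity
  have s2 : (0 : ℝ) ≤ 1024 * ((d : ℝ) + 1) * ((d : ℝ) + 4) * L ^ 2 := by positivity
  have s3 : (0 : ℝ) ≤ 32 * ((d : ℝ) + 1) ^ 2 * C6 d * L ^ 2 := by positivity
  have s4 : (0 : ℝ) ≤ 16 * d * C5' d * C6 d * (L : ℝ) ^ 2 := by positivity
  have s5 : (0 : ℝ) ≤ 8 * d * C6 d * L := by positivity
  have eK : K0 = C0 d + 3200 * ((d : ℝ) + 1) ^ 2 * ((d : ℝ) + 4) + C4G d L + 1024 * ((d : ℝ) + 1) * ((d : ℝ) + 4) * L ^ 2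
      + 32 * ((d : ℝ) + 1) ^ 2 * C6 d * L ^ 2 + 16 * d * C5' d * C6 d * (L : ℝ) ^ 2 + 8 * d * C6 d * L + 1 := rfl
  refine ⟨hα₀pos, ?_, ?_, ?_, ?_, ?_, ?_, ?_, ?_⟩
  · linarith [quarter (C0 d) hC0 (by rw [eK]; linarith)]
  · show 4 * (c2' d L / (4 * K0)) ≤ c2' d L
    rw [show 4 * (c2' d L / (4 * K0)) = c2' d L / K0 by field_simp]
    exact div_le_self hc2pos.le hK0
  · rw [mul_zero, add_zero, mul_one]
    have hx : 4 * (800 * ((d : ℝ) + 1) ^ 2 * ((d : ℝ) + 4)) * α₀ ≤ 1 / 4 := by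
      have := quarter _ s1 (by rw [eK]; linarith)
      linarith
    calc Real.exp (4 * (800 * ((d : ℝ) + 1) ^ 2 * ((d : ℝ) + 4)) * α₀) ≤ Real.exp (Real.log 2) := by
          apply Real.exp_le_exp.mpr
          linarith [Real.log_two_gt_d9]
      _ = 2 := Real.exp_log (by norm_num)
  · exact quarter _ hC4G (by rw [eK]; linarith)
  · linarith [quarter _ s2 (by rw [eK]; linarith)]
  · linarith [quarter _ s3 (by rw [eK]; linarith)]
  · linarith [quarter _ s4 (by rw [eK]; linarith)]
  · linarith [quarter _ s5 (by rw [eK]; linarith)]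

/-- **The `α₄`-smallness of `eq1117_existsUnique_kLevel` at `c = 0`, `B′₀ = 1`**, for `α₄ := 1/K4` with
`K4 = 400C6 + 24000(d+1)L + 16C4G + 8C2p + 1`. [folklore] -/
private theorem smallness_alpha4 (d L : ℕ) :
    let K4 : ℝ := 400 * C6 d + 24000 * ((d : ℝ) + 1) * L + 16 * C4G d L + 8 * C2p d + 1
    let α₄ : ℝ := 1 / K4
    0 < α₄ ∧ 200 * C6 d * (2 * α₄) ≤ 1 ∧ 12000 * ((d : ℝ) + 1) * L * (2 * α₄) ≤ 1 ∧ C4G d L * (8 * α₄) ≤ 1 / 2 ∧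
      40 * d * (0 : ℝ) + α₄ ≤ 1 / (4 * (1 : ℝ) * (2 * C2p d)) := by
  intro K4 α₄
  obtain ⟨-, hC6, -, hC4G, -, hC2, -⟩ := consts_nonneg d L
  have t1 : (0 : ℝ) ≤ 24000 * ((d : ℝ) + 1) * L := by positivity
  have hK4 : 1 ≤ K4 := by
    show (1 : ℝ) ≤ 400 * C6 d + _ + _ + _ + 1
    nlinarith
  have hK4pos : 0 < K4 := by linarith
  have hα₄pos : 0 < α₄ := by positivity
  have eK : K4 = 400 * C6 d + 24000 * ((d : ℝ) + 1) * L + 16 * C4G d L + 8 * C2p d + 1 := rfl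
  have bound : ∀ F : ℝ, 0 ≤ F → F ≤ K4 → F * α₄ ≤ 1 := by
    intro F hF hFK
    calc F * α₄ ≤ K4 * (1 / K4) := mul_le_mul hFK le_rfl hα₄pos.le hK4pos.le
      _ = 1 := by field_simp
  refine ⟨hα₄pos, ?_, ?_, ?_, ?_⟩
  · have := bound (400 * C6 d) (by positivity) (by rw [eK]; linarith)
    linarith
  · have := bound (24000 * ((d : ℝ) + 1) * L) t1 (by rw [eK]; linarith)
    linarith
  · have := bound (16 * C4G d L) (by positivity) (by rw [eK]; linarith)
    linarith
  · rw [mul_zero, zero_add, mul_one]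
    have := bound (8 * C2p d) (by positivity) (by rw [eK]; linarith)
    rw [le_div_iff₀ (by positivity)]
    linarith

end Arithmetic

/-! ## §2 The witness -/

section Witness

variable {𝔸 : Type*} [NormedRing 𝔸] [NormOneClass 𝔸] [NormedAlgebra ℂ 𝔸] [CompleteSpace 𝔸]

/-- **NON-VACUITY WITNESS FOR `eq1117_existsUnique_kLevel`**: at the trivial background `U₀ = 1`, field `B = 0`, `λ = 0`, `H′ = 0`,
`B′₀ = 1`, `c = 0`, the explicit `α₀(d, L)`, `α₄(d, L)` of §1, constraint sites `Λ_k = S` (ANY set `S`) and `Λ_j = ∅` (`j ≠ k`), and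
`u₁ := glev L _ 1 e^{0} k 0` ([3]'s gauge fixing of the trivial data), EVERY hypothesis of the k-level «exactly one solution of (1.117)»
theorem holds — certified by applying it: the `∃!` conclusion for this data.  (Consistency of the hypothesis class; no content about
Bałaban's objects.) [cite: Balaban1985RegularSpaces, (1.117)–(1.121) pp.96–97] -/
theorem eq1117_kLevel_witness (L : ℕ) (hL : 2 ≤ L) {G : Subgroup 𝔸ˣ} (hG : AvgClosed d L G) (k : ℕ) (S : Set (Site d)) :
    let K4 : ℝ := 400 * C6 d + 24000 * ((d : ℝ) + 1) * L + 16 * C4G d L + 8 * C2p d + 1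
    let α₄ : ℝ := 1 / K4
    let hL1 : 1 ≤ L := le_trans (by norm_num) hL
    let Λ : ℕ → Set (Site d) := fun j => if j = k then S else ∅
    let u₁ : Site d → 𝔸ˣ := glev L hL1 (1 : Site d → Fin d → 𝔸ˣ) (expCfg (0 : Site d → Fin d → 𝔸)) k 0
    ∃! X : XSpace d k 𝔸, ‖X‖ ≤ α₄ / (2 * (1 : ℝ)) ∧
      ∀ (j : ℕ) (hj : j ≤ k) (y : Site d),
        (y ∈ Λ j → X (⟨j, Nat.lt_succ_of_le hj⟩, y) =
          Cnl L (1 : Site d → Fin d → 𝔸ˣ) u₁ j ((0 : Site d → 𝔸) - (0 : XSpace d k 𝔸 →ₗ[ℂ] (Site d → 𝔸)) X) y) ∧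
        (y ∉ Λ j → X (⟨j, Nat.lt_succ_of_le hj⟩, y) = 0) := by
  intro K4 α₄ hL1 Λ u₁
  obtain ⟨hα₀, hα3, hα4, hsmall, hC4Gα₀, hs₄, hs₅, hs₆, hs₇⟩ := smallness_alpha0 d L hL
  obtain ⟨hα₄, hs₁, hs₂, hC4Gα₄, hsm⟩ := smallness_alpha4 d L
  obtain ⟨-, -, -, hC4G, -, -, hc3⟩ := consts_nonneg d L
  have h1G : ∀ (x : Site d) (κ : Fin d), (1 : Site d → Fin d → 𝔸ˣ) x κ ∈ G := fun _ _ => G.one_mem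
  -- the membership pattern of `Λ`
  have hΛ : ∀ j, j ≤ k → ∀ y ∈ Λ j, j = k := by
    intro j _ y hy
    by_contra hjk
    simp only [Λ, if_neg hjk] at hy
    exact hy
  refine eq1117_existsUnique_kLevel (B := (0 : Site d → Fin d → 𝔸)) (u₁ := u₁) (c := 0) (B₀' := 1) hL hL1 hG h1G Λ
    (0 : XSpace d k 𝔸 →ₗ[ℂ] (Site d → 𝔸)) 0 hα₀ hα3 hα4 le_rfl hα₄ one_pos
    ?_ ?_ ?_ ?_ ?_ ?_ ?_ hsmall ?_ ?_ ?_ hs₁ hs₂ ?_ hs₄ hs₅ hs₆ hs₇ hsm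
  · -- (1.33): the trivial background has no plaquette deviation
    intro j _ y _
    refine pdevOn_lt_of_forall (by positivity) fun x μ ν _ _ => ?_
    rw [hol_one, Units.val_one, sub_self, norm_zero]
    positivity
  · -- (1.69): `B = 0`
    intro j _ y _ x κ _ _
    simp
  · -- `u₁ = glev_k` on the top-level towers; lower levels are empty
    intro j hj y hy x _ _
    have := hΛ j hj y hy
    subst this
    rfl
  · -- (1.119), sites: `λ = 0`
    intro j _ y _ x _
    simp only [Pi.zero_apply, norm_zero]
    positivity
  · -- (1.119), bonds
    intro j _ y _ x κ _ _
    simp only [Pi.zero_apply, cj_apply, mul_zero, zero_mul, sub_self, norm_zero]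
    positivity
  · -- `H′ = 0`, sites
    intro X x
    simp only [LinearMap.zero_apply, Pi.zero_apply, norm_zero]
    positivity
  · -- `H′ = 0`, bonds
    intro j _ y _ X x κ _ _
    simp only [LinearMap.zero_apply, Pi.zero_apply, cj_apply, mul_zero, zero_mul, sub_self, norm_zero]
    positivity
  · -- `2c ≤ c₃`
    simpa using hc3
  · -- `128 d c ≤ 1`
    simp
  · -- `40 d c ≤ 1/200`
    simp
  · -- `C4G (α₀ + 40dc + 4(2α₄)) ≤ 1`
    rw [mul_zero, add_zero, mul_add]
    have e : C4G d L * (4 * (2 * α₄)) = C4G d L * (8 * α₄) := by ring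
    rw [e]
    linarith

end Witness

#print axioms eq1117_kLevel_witness

/-! ## §3 (v1.1) The witness at ALL levels simultaneously: `u₁ = 1`, arbitrary `Λ_j` at every `j ≤ k` -/

section WitnessAllLevels

variable {𝔸 : Type*} [NormedRing 𝔸] [NormOneClass 𝔸] [NormedAlgebra ℂ 𝔸] [CompleteSpace 𝔸]

open B7GaugeFixingAtBackground (glev_one_right_apply)
open B7Prop3GeneralRotated (expCfg_zero)

/-- **NON-VACUITY WITNESS FOR `eq1117_existsUnique_kLevel` WITH EVERY LEVEL INHABITED**: at the trivial background
`U₀ = 1`, field `B = 0` (so `U₁ = e^{0} = 1`), `λ = 0`, `H′ = 0`, `B′₀ = 1`, `c = 0`, the explicit `α₀(d, L)`, `α₄(d, L)` of §1,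
an ARBITRARY family of constraint sets `Λ : ℕ → Set (Site d)` (constraint sites at every level `j ≤ k` at once), and the
IDENTITY gauge transformation `u₁ := 1`, EVERY hypothesis of the k-level «exactly one solution of (1.117)» theorem holds —
certified by applying it: the `∃!` conclusion for this data.  The one hypothesis §2 could meet at a single level only,
`u₁ = glev L _ U₀ (expCfg B) j 0` on the level-`j` towers for all `j`, holds for `u₁ = 1` because the gauge fixing of [3]
applied to a field equal to its background is the identity at every level (`B7GaugeFixingAtBackground.glev_one_right`,
[Balaban1985Averaging] (76)–(77)/(87)) and `e^{0} = 1` (`B7Prop3GeneralRotated.expCfg_zero`).  (Consistency of the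
hypothesis class with all levels populated; no content about Bałaban's objects.)
[cite: Balaban1985RegularSpaces, (1.117)–(1.121) pp.96–97] -/
theorem eq1117_kLevel_witness_allLevels (L : ℕ) (hL : 2 ≤ L) {G : Subgroup 𝔸ˣ} (hG : AvgClosed d L G) (k : ℕ)
    (Λ : ℕ → Set (Site d)) :
    let K4 : ℝ := 400 * C6 d + 24000 * ((d : ℝ) + 1) * L + 16 * C4G d L + 8 * C2p d + 1
    let α₄ : ℝ := 1 / K4
    ∃! X : XSpace d k 𝔸, ‖X‖ ≤ α₄ / (2 * (1 : ℝ)) ∧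
      ∀ (j : ℕ) (hj : j ≤ k) (y : Site d),
        (y ∈ Λ j → X (⟨j, Nat.lt_succ_of_le hj⟩, y) =
          Cnl L (1 : Site d → Fin d → 𝔸ˣ) (1 : Site d → 𝔸ˣ) j
            ((0 : Site d → 𝔸) - (0 : XSpace d k 𝔸 →ₗ[ℂ] (Site d → 𝔸)) X) y) ∧
        (y ∉ Λ j → X (⟨j, Nat.lt_succ_of_le hj⟩, y) = 0) := by
  intro K4 α₄
  have hL1 : 1 ≤ L := le_trans (by norm_num) hL
  obtain ⟨hα₀, hα3, hα4, hsmall, hC4Gα₀, hs₄, hs₅, hs₆, hs₇⟩ := smallness_alpha0 d L hL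
  obtain ⟨hα₄, hs₁, hs₂, hC4Gα₄, hsm⟩ := smallness_alpha4 d L
  obtain ⟨-, -, -, hC4G, -, -, hc3⟩ := consts_nonneg d L
  have h1G : ∀ (x : Site d) (κ : Fin d), (1 : Site d → Fin d → 𝔸ˣ) x κ ∈ G := fun _ _ => G.one_mem
  refine eq1117_existsUnique_kLevel (B := (0 : Site d → Fin d → 𝔸)) (u₁ := (1 : Site d → 𝔸ˣ)) (c := 0) (B₀' := 1)
    hL hL1 hG h1G Λ (0 : XSpace d k 𝔸 →ₗ[ℂ] (Site d → 𝔸)) 0 hα₀ hα3 hα4 le_rfl hα₄ one_pos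
    ?_ ?_ ?_ ?_ ?_ ?_ ?_ hsmall ?_ ?_ ?_ hs₁ hs₂ ?_ hs₄ hs₅ hs₆ hs₇ hsm
  · -- (1.33): the trivial background has no plaquette deviation
    intro j _ y _
    refine pdevOn_lt_of_forall (by positivity) fun x μ ν _ _ => ?_
    rw [hol_one, Units.val_one, sub_self, norm_zero]
    positivity
  · -- (1.69): `B = 0`
    intro j _ y _ x κ _ _
    simp
  · -- `u₁ = 1 = glev_j(1, e^{0})` on EVERY tower, at every level (the new input)
    intro j _ y _ x _ _
    rw [expCfg_zero, glev_one_right_apply, Pi.one_apply]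
  · -- (1.119), sites: `λ = 0`
    intro j _ y _ x _
    simp only [Pi.zero_apply, norm_zero]
    positivity
  · -- (1.119), bonds
    intro j _ y _ x κ _ _
    simp only [Pi.zero_apply, cj_apply, mul_zero, zero_mul, sub_self, norm_zero]
    positivity
  · -- `H′ = 0`, sites
    intro X x
    simp only [LinearMap.zero_apply, Pi.zero_apply, norm_zero]
    positivity
  · -- `H′ = 0`, bonds
    intro j _ y _ X x κ _ _
    simp only [LinearMap.zero_apply, Pi.zero_apply, cj_apply, mul_zero, zero_mul, sub_self, norm_zero]
    positivity
  · -- `2c ≤ c₃`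
    simpa using hc3
  · -- `128 d c ≤ 1`
    simp
  · -- `40 d c ≤ 1/200`
    simp
  · -- `C4G (α₀ + 40dc + 4(2α₄)) ≤ 1`
    rw [mul_zero, add_zero, mul_add]
    have e : C4G d L * (4 * (2 * α₄)) = C4G d L * (8 * α₄) := by ring
    rw [e]
    linarith

/-- The all-levels witness specialised to ONE constraint site per level along a tower of block centres — the shape the
inductive use of Thm 4 meets (a constraint at the centre `L^{k−j}·y₀`-block at every level): every `Λ_j` a singleton.
Immediate from `eq1117_kLevel_witness_allLevels`; recorded as the reading a booking-time A1–A6 check asks for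
(«inhabited with constraints at all k+1 levels»). [cite: Balaban1985RegularSpaces, (1.117)–(1.121) pp.96–97] -/
theorem eq1117_kLevel_witness_singletons (L : ℕ) (hL : 2 ≤ L) {G : Subgroup 𝔸ˣ} (hG : AvgClosed d L G) (k : ℕ)
    (y₀ : ℕ → Site d) :
    let K4 : ℝ := 400 * C6 d + 24000 * ((d : ℝ) + 1) * L + 16 * C4G d L + 8 * C2p d + 1
    let α₄ : ℝ := 1 / K4
    ∃! X : XSpace d k 𝔸, ‖X‖ ≤ α₄ / (2 * (1 : ℝ)) ∧
      ∀ (j : ℕ) (hj : j ≤ k) (y : Site d),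
        (y ∈ ({y₀ j} : Set (Site d)) → X (⟨j, Nat.lt_succ_of_le hj⟩, y) =
          Cnl L (1 : Site d → Fin d → 𝔸ˣ) (1 : Site d → 𝔸ˣ) j
            ((0 : Site d → 𝔸) - (0 : XSpace d k 𝔸 →ₗ[ℂ] (Site d → 𝔸)) X) y) ∧
        (y ∉ ({y₀ j} : Set (Site d)) → X (⟨j, Nat.lt_succ_of_le hj⟩, y) = 0) :=
  eq1117_kLevel_witness_allLevels L hL hG k fun j => {y₀ j}

end WitnessAllLevels

#print axioms eq1117_kLevel_witness_allLevels

end Literature.MathematicalPhysics.QuantumFieldTheory.Balaban1983to89.B8Eq1117KLevelWitness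

end
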